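import Mathlib
import Summits.NavierStokesRegularity.NavierStokesRegularity.Theorems.LerayQuarterDissipationFiniteDissipationLiouvilleThresholdKStretching
import Summits.NavierStokesRegularity.NavierStokesRegularity.Theorems.LerayQuarterDissipationFiniteDissipationLiouvilleSmallDissipationGapBudget
import HarnessLib

/-!
# The dissipation threshold of the finite-dissipation stratum, file 2: the localised
  similarity-enstrophy budget at `θ⁴ ≤ 64/27` with the HÖLDER DEFECT as its slack
  (route `LerayQuarterDissipation`, crux `FiniteDissipationLiouville` stmt-NavierStokesRegularity-22144;
  lead prover g14, helper — `K`-direction analogue of `…ThresholdBudget`)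

HONEST FRAMING. Label-free analysis helper about a HYPOTHETICAL object (a Type-I ancient mild field
in the KNSS gauge) under the additional hypothesis `∫‖DU(s)‖² ≤ K_U` on the similarity slices.
Nothing here bears on Navier–Stokes regularity or blow-up; no summit is proved.

CONTENTS. `deriv_sqCutoffEnstrophy_add_hoelderDefect_le`: for `θ = √K_U(√K_S)³` with `θ⁴ ≤ 64/27`
(the threshold of `…SmallDissipationGapSharperBudget` INCLUDED) there is `L ≥ 0` with
`Z_R' + H_R ≤ (L/R)(Z_R + ∫_{B̄_{2R}}‖Ω‖²)` for all `R ≥ 1`, all `s`, where `H_R ≥ 0` is the Hölder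
defect of `g = φ_RΩ` carried by `…ThresholdKStretching`. At the threshold no damping survives; the
identity `deriv_sqCutoffEnstrophy_eq` (T31⁗), the flux bounds, and the weights `δ = 1/R`,
`m⁴ = 3θ₁(1+δ)/4`, `θ₁ = (64/27)^{1/4}` make every other term `O((Z_R + I_R)/R)`. Files 3–5 turn
«the defect is small somewhere on a bounded orbit» into «no singular member at the threshold».
[folklore energy method; Ladyzhenskaya's inequality]
-/

noncomputable section

set_option linter.dupNamespace false

namespace Summit.NavierStokesRegularity.NavierStokesRegularity.Theorems.FiniteDissipationLiouville.ThresholdK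

open MeasureTheory Set Filter Topology Metric InnerProductSpace Function Real
open scoped RealInnerProductSpace Laplacian ContDiff
open Literature.Analysis Literature.Analysis.FluidPDE
open Summit.NavierStokesRegularity.NavierStokesRegularity.Theorems
open Summit.NavierStokesRegularity.NavierStokesRegularity.Theorems.GaussianGap
open Summit.NavierStokesRegularity.NavierStokesRegularity.Theorems.SimilarityEnstrophy
open Summit.NavierStokesRegularity.NavierStokesRegularity.Theorems.SmallDissipationGap

variable {C : ℝ} {V : ℝ → (EuclideanSpace ℝ (Fin 3)) → (EuclideanSpace ℝ (Fin 3))}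

/-- **The localised similarity-enstrophy budget AT AND BELOW the dissipation threshold, with the
Hölder defect as slack.** Let `V` be a KNSS-gauge Type-I field with `∫‖DU(s)‖² ≤ K_U` for all `s`
and `θ = √K_U·(√K_S)³` with `θ⁴ ≤ 64/27`. Then there is `L ≥ 0` such that for every `R ≥ 1` and
every `s`: `Z_R'(s) + H_R(s) ≤ (L/R)(Z_R(s) + ∫_{B̄_{2R}}‖Ω(s)‖²)`, where `Z_R = ∫φ_R²‖Ω‖²` and
`H_R(s) = 2√K_U((‖g‖₂‖g‖₆³)^{1/2} − ‖g‖₄²) ≥ 0`, `g = φ_R Ω(s)`, is the Hölder defect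
(`…ThresholdKStretching`). Proof: enlarge `θ` to `θ₁ = (64/27)^{1/4}`, take the product-rule weight
`δ = 1/R` and the Young weight `m⁴ = 3θ₁(1+δ)/4`: the dissipation `−2∫φ²‖∇Ω‖²_F` is cancelled
exactly, the `Z`-coefficient is `½((1+δ)³ − 1) ≤ 7/(2R)`, and the collar `(2/δ)(c₁/R)²` is `2c₁²/R`.
No damping is left — the defect is the whole slack. [folklore energy method] -/
theorem deriv_sqCutoffEnstrophy_add_hoelderDefect_le (hV : IsTypeIAncientMild C V) {KU : ℝ}
    (hint : ∀ s : ℝ, Integrable (fun y => ‖fderiv ℝ (lerayOrbit V s) y‖ ^ 2))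
    (hKU : ∀ s : ℝ, ∫ y, ‖fderiv ℝ (lerayOrbit V s) y‖ ^ 2 ≤ KU)
    (hθ : (Real.sqrt KU * Real.sqrt (SNormLESNormFDerivOfEqConst (EuclideanSpace ℝ (Fin 3)) (volume : Measure (EuclideanSpace ℝ (Fin 3))) 2 : ℝ) ^ 3) ^ 4
      ≤ 64 / 27) :
    ∃ L : ℝ, 0 ≤ L ∧ ∀ R : ℝ, 1 ≤ R → ∀ s : ℝ,
      deriv (fun σ => ∫ y, smoothTransition (2 - ‖y‖ ^ 2 / R ^ 2) ^ 2 * ‖lerayVorticity V σ y‖ ^ 2) s +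
        2 * Real.sqrt KU *
          (Real.sqrt (Real.sqrt (∫ y, ‖smoothTransition (2 - ‖y‖ ^ 2 / R ^ 2) • lerayVorticity V s y‖ ^ 2) *
              Real.sqrt (∫ y, ‖smoothTransition (2 - ‖y‖ ^ 2 / R ^ 2) • lerayVorticity V s y‖ ^ 6)) -
            Real.sqrt (∫ y, ‖smoothTransition (2 - ‖y‖ ^ 2 / R ^ 2) • lerayVorticity V s y‖ ^ 4)) ≤
        L / R * ((∫ y, smoothTransition (2 - ‖y‖ ^ 2 / R ^ 2) ^ 2 * ‖lerayVorticity V s y‖ ^ 2) +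
          ∫ y in closedBall (0 : (EuclideanSpace ℝ (Fin 3))) (2 * R), ‖lerayVorticity V s y‖ ^ 2) := by
  obtain ⟨c₁, hc₁0, hc₁⟩ :=
    exists_norm_fderiv_smoothTransition_cutoff_le (E := (EuclideanSpace ℝ (Fin 3)))
  obtain ⟨c₂, hc₂0, hc₂⟩ :=
    exists_abs_laplacian_smoothTransition_cutoff_le (E := (EuclideanSpace ℝ (Fin 3)))
  have hC : 0 ≤ C := hV.nonneg
  set θ : ℝ := Real.sqrt KU * Real.sqrt (SNormLESNormFDerivOfEqConst (EuclideanSpace ℝ (Fin 3)) (volume : Measure (EuclideanSpace ℝ (Fin 3))) 2 : ℝ) ^ 3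
    with hθdef
  have hθ0 : 0 ≤ θ := by positivity
  -- enlarge `θ` to the threshold value `θ₁ = (64/27)^{1/4}`
  set θ₁ : ℝ := Real.sqrt (Real.sqrt (64 / 27)) with hθ₁
  have hθ₁pos : 0 < θ₁ := Real.sqrt_pos.2 (Real.sqrt_pos.2 (by norm_num))
  have hθ₁4 : θ₁ ^ 4 = 64 / 27 := by
    rw [show θ₁ ^ 4 = (θ₁ ^ 2) ^ 2 by ring, hθ₁, Real.sq_sqrt (Real.sqrt_nonneg _),
      Real.sq_sqrt (by norm_num : (0 : ℝ) ≤ 64 / 27)]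
  have hθθ₁ : θ ≤ θ₁ :=
    (pow_le_pow_iff_left₀ hθ0 hθ₁pos.le (by norm_num : (4 : ℕ) ≠ 0)).1 (hθ.trans_eq hθ₁4.symm)
  refine ⟨7 / 2 + 2 * C * c₁ + 2 * c₂ + 8 * c₁ ^ 2, by positivity, fun R hR1 s => ?_⟩
  have hR : 0 < R := lt_of_lt_of_le one_pos hR1
  -- the product-rule weight `δ = 1/R` and the Young weight `m⁴ = 3 θ₁ (1+δ)/4`
  set δ : ℝ := 1 / R with hδdef
  have hδpos : 0 < δ := by positivity
  have hδ1 : δ ≤ 1 := by rw [hδdef, div_le_one hR]; exact hR1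
  set q : ℝ := 3 * θ₁ * (1 + δ) / 4 with hq
  have hqpos : 0 < q := by positivity
  set m : ℝ := Real.sqrt (Real.sqrt q) with hm
  have hmpos : 0 < m := Real.sqrt_pos.2 (Real.sqrt_pos.2 hqpos)
  have hm4 : m ^ 4 = q := by
    rw [show m ^ 4 = (m ^ 2) ^ 2 by ring, hm, Real.sq_sqrt (Real.sqrt_nonneg _), Real.sq_sqrt hqpos.le]
  have hm12 : m ^ 12 = q ^ 3 := by rw [show m ^ 12 = (m ^ 4) ^ 3 by ring, hm4]
  rw [deriv_sqCutoffEnstrophy_eq hV hR s]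
  set φ : (EuclideanSpace ℝ (Fin 3)) → ℝ := fun z => smoothTransition (2 - ‖z‖ ^ 2 / R ^ 2) with hφdef
  set Ω := lerayVorticity V s with hΩdef
  set U := lerayOrbit V s with hUdef
  set I : ℝ := ∫ y in closedBall (0 : (EuclideanSpace ℝ (Fin 3))) (2 * R), ‖Ω y‖ ^ 2 with hIdef
  set Z : ℝ := ∫ y, φ y ^ 2 * ‖Ω y‖ ^ 2 with hZdef
  set D : ℝ := ∫ y, φ y ^ 2 * frobeniusNormSq (fderiv ℝ Ω y) with hDdef
  have hI0 : 0 ≤ I := integral_nonneg fun y => sq_nonneg _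
  have hZ0 : 0 ≤ Z := integral_nonneg fun y => mul_nonneg (sq_nonneg _) (sq_nonneg _)
  have hD0 : 0 ≤ D := integral_nonneg fun y => mul_nonneg (sq_nonneg _) (frobeniusNormSq_nonneg _)
  have hΩ1 : ContDiff ℝ 1 Ω := signedBudget_contDiff_lerayVorticity_slice hV s (n := 1)
  have hcΩ : Continuous Ω := hΩ1.continuous
  have hUC : ∀ y, ‖U y‖ ≤ C := fun y => norm_lerayOrbit_le_of_typeI hV s y
  have hw1 : ContDiff ℝ 1 fun z : (EuclideanSpace ℝ (Fin 3)) => φ z ^ 2 := contDiff_sqCutoff (n := 1) R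
  have hw2 : ContDiff ℝ 2 fun z : (EuclideanSpace ℝ (Fin 3)) => φ z ^ 2 := contDiff_sqCutoff (n := 2) R
  have hcDw : Continuous (fderiv ℝ fun z : (EuclideanSpace ℝ (Fin 3)) => φ z ^ 2) := hw1.continuous_fderiv one_ne_zero
  -- (1) drift flux `≤ 0`
  have hDrift : (∫ y, fderiv ℝ (fun z : (EuclideanSpace ℝ (Fin 3)) => φ z ^ 2) y y * ‖Ω y‖ ^ 2) ≤ 0 :=
    integral_nonpos fun y => mul_nonpos_iff.2 (Or.inr ⟨fderiv_sqCutoff_self_nonpos R y, sq_nonneg _⟩)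
  -- (2) transport flux
  have hT : |∫ y, fderiv ℝ (fun z : (EuclideanSpace ℝ (Fin 3)) => φ z ^ 2) y (U y) * ‖Ω y‖ ^ 2| ≤ C * (2 * (c₁ / R)) * I := by
    refine abs_integral_le_of_weight_sq hcΩ (w := fun y => C * ‖fderiv ℝ (fun z : (EuclideanSpace ℝ (Fin 3)) => φ z ^ 2) y‖)
      (continuous_const.mul hcDw.norm) (fun y hy => ?_) (fun y _ => ?_) (fun y => ?_)
    · show C * ‖fderiv ℝ (fun z : (EuclideanSpace ℝ (Fin 3)) => φ z ^ 2) y‖ = 0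
      rw [hφdef, fderiv_sqCutoff_eq_zero hR hy, norm_zero, mul_zero]
    · exact mul_le_mul_of_nonneg_left (norm_fderiv_sqCutoff_le hc₁ hR y) hC
    · rw [abs_mul, abs_of_nonneg (sq_nonneg ‖Ω y‖)]
      have e1 : |fderiv ℝ (fun z : (EuclideanSpace ℝ (Fin 3)) => φ z ^ 2) y (U y)| ≤
          ‖fderiv ℝ (fun z : (EuclideanSpace ℝ (Fin 3)) => φ z ^ 2) y‖ * C := by
        rw [← Real.norm_eq_abs]
        exact (ContinuousLinearMap.le_opNorm _ _).trans
          (mul_le_mul_of_nonneg_left (hUC y) (norm_nonneg _))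
      calc |fderiv ℝ (fun z : (EuclideanSpace ℝ (Fin 3)) => φ z ^ 2) y (U y)| * ‖Ω y‖ ^ 2
          ≤ (‖fderiv ℝ (fun z : (EuclideanSpace ℝ (Fin 3)) => φ z ^ 2) y‖ * C) * ‖Ω y‖ ^ 2 :=
            mul_le_mul_of_nonneg_right e1 (sq_nonneg _)
        _ = C * ‖fderiv ℝ (fun z : (EuclideanSpace ℝ (Fin 3)) => φ z ^ 2) y‖ * ‖Ω y‖ ^ 2 := by ring
  -- (3) viscous flux
  have hVisc : |∫ y, ‖Ω y‖ ^ 2 * (Δ (fun z : (EuclideanSpace ℝ (Fin 3)) => φ z ^ 2)) y| ≤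
      (2 * (c₂ / R ^ 2) + 6 * (c₁ / R) ^ 2) * I := by
    refine abs_integral_le_of_weight_sq hcΩ (w := fun y => |(Δ (fun z : (EuclideanSpace ℝ (Fin 3)) => φ z ^ 2)) y|)
      (continuous_laplacian hw2).abs (fun y hy => ?_) (fun y _ => ?_) (fun y => ?_)
    · show |(Δ (fun z : (EuclideanSpace ℝ (Fin 3)) => φ z ^ 2)) y| = 0
      rw [hφdef, laplacian_sqCutoff_eq_zero hR hy, abs_zero]
    · exact abs_laplacian_sqCutoff_le hc₁ hc₂ hR y
    · rw [abs_mul, abs_of_nonneg (sq_nonneg ‖Ω y‖), mul_comm]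
  -- (4) stretching with the Hölder defect, weighted, with `θ` enlarged to `θ₁`
  have hS0 := two_mul_integral_sqCutoff_stretching_add_hoelderDefect_le hV hc₁ hR s (hint s) (hKU s)
    hδpos hmpos
  rw [← hθdef] at hS0
  set H : ℝ := 2 * Real.sqrt KU *
    (Real.sqrt (Real.sqrt (∫ y, ‖φ y • Ω y‖ ^ 2) * Real.sqrt (∫ y, ‖φ y • Ω y‖ ^ 6)) -
      Real.sqrt (∫ y, ‖φ y • Ω y‖ ^ 4)) with hHdef
  have hS : 2 * (∫ y, φ y ^ 2 * ⟪fderiv ℝ U y (Ω y), Ω y⟫) + H ≤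
      (θ₁ * m ^ 12 / 2) * Z + (3 * θ₁ / (2 * m ^ 4)) * (1 + δ) * D +
        (3 * θ₁ / (2 * m ^ 4)) * (1 + δ⁻¹) * (c₁ / R) ^ 2 * I := by
    have h1 : (θ * m ^ 12 / 2) * Z ≤ (θ₁ * m ^ 12 / 2) * Z :=
      mul_le_mul_of_nonneg_right (by gcongr) hZ0
    have h2 : (3 * θ / (2 * m ^ 4)) * (1 + δ) * D ≤ (3 * θ₁ / (2 * m ^ 4)) * (1 + δ) * D := by
      have : 3 * θ / (2 * m ^ 4) ≤ 3 * θ₁ / (2 * m ^ 4) := by gcongr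
      exact mul_le_mul_of_nonneg_right (mul_le_mul_of_nonneg_right this (by linarith)) hD0
    have h3 : (3 * θ / (2 * m ^ 4)) * (1 + δ⁻¹) * (c₁ / R) ^ 2 * I ≤
        (3 * θ₁ / (2 * m ^ 4)) * (1 + δ⁻¹) * (c₁ / R) ^ 2 * I := by
      have : 3 * θ / (2 * m ^ 4) ≤ 3 * θ₁ / (2 * m ^ 4) := by gcongr
      have hδi : 0 ≤ 1 + δ⁻¹ := by positivity
      exact mul_le_mul_of_nonneg_right (mul_le_mul_of_nonneg_right
        (mul_le_mul_of_nonneg_right this hδi) (sq_nonneg _)) hI0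
    linarith [hS0, h1, h2, h3]
  -- the chosen weights: dissipation coefficient `= 2`, Z-coefficient `(1+δ)³/2`
  have hcoefD : (3 * θ₁ / (2 * m ^ 4)) * (1 + δ) = 2 := by
    rw [hm4, hq]; field_simp; ring
  have hcoefZ : θ₁ * m ^ 12 / 2 = (1 + δ) ^ 3 / 2 := by
    rw [hm12, hq]
    have e : θ₁ * (3 * θ₁ * (1 + δ) / 4) ^ 3 / 2 = 27 / 128 * θ₁ ^ 4 * (1 + δ) ^ 3 := by ring
    rw [e, hθ₁4]; ring
  have hcoefI : (3 * θ₁ / (2 * m ^ 4)) * (1 + δ⁻¹) = 2 / δ := by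
    rw [hm4, hq]; field_simp; ring
  rw [hcoefD, hcoefZ, hcoefI] at hS
  -- absorption
  have hT' := (le_abs_self _).trans hT
  have hVisc' := (le_abs_self _).trans hVisc
  have hR2 : 1 / R ^ 2 ≤ 1 / R := by
    apply one_div_le_one_div_of_le hR
    calc R = 1 * R := (one_mul R).symm
      _ ≤ R * R := mul_le_mul_of_nonneg_right hR1 hR.le
      _ = R ^ 2 := (sq R).symm
  have hc₂R : c₂ / R ^ 2 ≤ c₂ / R := by
    have := mul_le_mul_of_nonneg_left hR2 hc₂0
    simpa only [mul_one_div] using this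
  have hc₁R : (c₁ / R) ^ 2 ≤ c₁ ^ 2 / R := by
    rw [div_pow]
    have := mul_le_mul_of_nonneg_left hR2 (sq_nonneg c₁)
    simpa only [mul_one_div] using this
  have a1 : (1 + δ) ^ 3 / 2 * Z ≤ 1 / 2 * Z + (7 / 2) / R * Z := by
    have hδ2 : δ ^ 2 ≤ δ := by
      have h := mul_le_mul_of_nonneg_left hδ1 hδpos.le
      rw [mul_one, ← sq] at h
      exact h
    have hδ3 : δ ^ 3 ≤ δ := by
      have h := mul_le_mul_of_nonneg_left hδ2 hδpos.le
      have e1 : δ * δ ^ 2 = δ ^ 3 := by ring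
      have e2 : δ * δ = δ ^ 2 := by ring
      rw [e1, e2] at h
      exact h.trans hδ2
    have h2 : (1 + δ) ^ 3 ≤ 1 + 7 * δ := by
      have e : (1 + δ) ^ 3 = 1 + 3 * δ + 3 * δ ^ 2 + δ ^ 3 := by ring
      rw [e]
      linarith only [hδ2, hδ3]
    have e3 : (7 / 2) / R = 7 / 2 * δ := by rw [hδdef]; ring
    have h3 : (1 + δ) ^ 3 / 2 ≤ 1 / 2 + (7 / 2) / R := by
      rw [e3]
      linarith only [h2]
    have h4 := mul_le_mul_of_nonneg_right h3 hZ0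
    have e4 : (1 / 2 + (7 / 2) / R) * Z = 1 / 2 * Z + (7 / 2) / R * Z := by ring
    rw [e4] at h4
    exact h4
  have a2 : C * (2 * (c₁ / R)) * I = (2 * C * c₁) / R * I := by ring
  have a3 : 2 / δ * (c₁ / R) ^ 2 * I = (2 * c₁ ^ 2) / R * I := by
    rw [hδdef]
    field_simp
  have a4 : (2 * (c₂ / R ^ 2) + 6 * (c₁ / R) ^ 2) * I ≤ (2 * c₂ + 6 * c₁ ^ 2) / R * I := by
    have h : 2 * (c₂ / R ^ 2) + 6 * (c₁ / R) ^ 2 ≤ (2 * c₂ + 6 * c₁ ^ 2) / R := by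
      rw [show (2 * c₂ + 6 * c₁ ^ 2) / R = 2 * (c₂ / R) + 6 * (c₁ ^ 2 / R) by ring]
      linarith [hc₂R, hc₁R]
    exact mul_le_mul_of_nonneg_right h hI0
  have a5 : (7 / 2) / R * Z + ((2 * C * c₁) / R * I + (2 * c₂ + 6 * c₁ ^ 2) / R * I + (2 * c₁ ^ 2) / R * I) ≤
      (7 / 2 + 2 * C * c₁ + 2 * c₂ + 8 * c₁ ^ 2) / R * (Z + I) := by
    have e : (7 / 2 + 2 * C * c₁ + 2 * c₂ + 8 * c₁ ^ 2) / R * (Z + I) =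
        (7 / 2) / R * Z + ((2 * C * c₁) / R * I + (2 * c₂ + 6 * c₁ ^ 2) / R * I + (2 * c₁ ^ 2) / R * I) +
          ((2 * C * c₁ + 2 * c₂ + 8 * c₁ ^ 2) / R * Z + (7 / 2) / R * I) := by ring
    have h1 : 0 ≤ (2 * C * c₁ + 2 * c₂ + 8 * c₁ ^ 2) / R * Z := by positivity
    have h2 : 0 ≤ (7 / 2) / R * I := by positivity
    rw [e]
    linarith
  linarith [hDrift, hT', hVisc', hS, a1, a2, a3, a4, a5]

end Summit.NavierStokesRegularity.NavierStokesRegularity.Theorems.FiniteDissipationLiouville.ThresholdK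

end
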